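import Literature.NumberTheory.GaloisRepresentations.HeckeLFunctionEntireContinuationProofs
import Literature.NumberTheory.GaloisRepresentations.HeckeCharacterModulusExponentProofs
import HarnessLib

/-!
# Entire continuation of `L(s, χ)` for a Hecke character of NON-NEGATIVE EXPONENT which is not a norm twist
# (Tate 1950, Thm. 4.4.1, translated along `χ = χ₀ · ‖·‖^σ`)

Topic `NumberTheory/GaloisRepresentations`, namespace `Literature.NumberTheory.GaloisRepresentations.HeckeCharacter`;
sequel of `HeckeLFunctionEntireContinuationProofs` (Tate's theorem for UNITARY characters,
`heckeLFunction_hasEntireContinuation_of_not_isNormTwist_holds`) and `HeckeCharacterModulusExponentProofs` (every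
quasi-character is `χ₀ · ‖·‖^σ` with `χ₀` unitary, Weil BNT VII §3). PROOFS ONLY (no definition, no named fact, no
`sorry`). Requested by the Katz–Hsieh layer of route `BiquadraticEisensteinDescent` (`Summits/BirchSwinnertonDyer`,
crux `EisensteinHeartFlatCMInertBadKPrime`, hypothesis (C) of `…KatzHsiehDisplay.display_relation`: the Katz frames
`KatzCM.IsLine` / `IsBaseChangeLine` carry a binder `hL : LFunction.HasEntireContinuation (heckeLFunction (λ·ρ))` for
characters `λρ` of weight `−k ≤ −1`, i.e. of exponent `k/2 ≥ 0`, which are not unitary).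

## What is proved

* `not_isNormTwist_of_mul_normPow` — if `χ = χ₀ · ν` with `ν = ‖·‖^σ` and `χ` is not a norm twist, then `χ₀` is not.
* **`hasEntireContinuation_heckeLFunction_of_norm_eq_rpow`** — if `‖χ(x)‖ = ‖x‖^σ` with `σ ≥ 0` and `χ` is not a
  norm twist, then `L(s, χ)` (`heckeLFunction χ`, the Euler product) has an entire continuation in the tree's sense
  (`LFunction.HasEntireContinuation`: an entire `g` with `g = L(·, χ)` on `re s > 1`): write `χ = χ₀ · ‖·‖^σ`
  (`exists_isUnitary_mul_of_norm_eq_rpow`), take Tate's entire continuation `g₀` of `L(·, χ₀)` and put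
  `g(s) = g₀(s + σ)`; on `re s > 1` one has `re (s + σ) > 1` (this is where `σ ≥ 0` is used) and
  `L(s, χ₀‖·‖^σ) = L(s + σ, χ₀)` (`heckeLFunction_mul_eq_of_forall_apply_eq_cpow`, an identity of Euler products).
* `hasEntireContinuation_heckeLFunction_of_exponent_nonneg` — the same with the exponent supplied by
  `exists_norm_apply_eq_ideleNorm_rpow` and the sign as the hypothesis `0 ≤ σ` on THAT exponent.

References: [TateThesis1967] Thm. 4.4.1; [WeilBNT1967] Ch. VII §3 (Cor. 1–2 of Prop. 7); Iwasawa 1964 §3.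
-/

noncomputable section

open NumberField IsDedekindDomain Filter Complex

namespace Literature.NumberTheory.GaloisRepresentations

namespace HeckeCharacter

variable {K : Type} [Field K] [NumberField K]

/-- If `χ = χ₀ · ν` with `ν = ‖·‖^σ` (`σ ∈ ℝ`) and `χ` is not a norm twist, then `χ₀` is not a norm twist
(else `χ = ‖·‖^{z+σ}`). [cite: WeilBNT1967, Ch. VII §3 (Cor. 1–2 of Prop. 7)] -/
theorem not_isNormTwist_of_mul_normPow {χ χ₀ ν : HeckeCharacter K} {σ : ℝ}
    (hν : ∀ x : ideleGroup K, ((ν x : ℂˣ) : ℂ) = ((ideleNorm x : ℝ) : ℂ) ^ (σ : ℂ)) (h : χ = χ₀ * ν)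
    (hnt : ¬ χ.IsNormTwist) : ¬ χ₀.IsNormTwist := by
  rintro ⟨z, hz⟩
  refine hnt ⟨z + σ, fun x => ?_⟩
  have h0 : ((ideleNorm x : ℝ) : ℂ) ≠ 0 := Complex.ofReal_ne_zero.mpr (ideleNorm_pos' K x).ne'
  rw [h, mul_apply, Units.val_mul, hz x, hν x, ← Complex.cpow_add _ _ h0]

/-- **Entire continuation for a non-norm-twist character of non-negative exponent.** If `‖χ(x)‖ = ‖x‖^σ` for all
ideles `x` with `0 ≤ σ`, and `χ` is not a norm twist, then the Euler product `L(s, χ)` has an entire continuation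
(an entire `g` agreeing with `heckeLFunction χ` on `re s > 1`): `g(s) = g₀(s + σ)` for Tate's entire continuation
`g₀` of the unitary part `χ₀ = χ · ‖·‖^{−σ}`. [cite: TateThesis1967, Thm. 4.4.1]
[cite: WeilBNT1967, Ch. VII §3 (Cor. 1–2 of Prop. 7)] -/
theorem hasEntireContinuation_heckeLFunction_of_norm_eq_rpow {χ : HeckeCharacter K} {σ : ℝ}
    (hσ : ∀ x : ideleGroup K, ‖((χ x : ℂˣ) : ℂ)‖ = ideleNorm x ^ σ) (h0 : 0 ≤ σ)
    (hnt : ¬ χ.IsNormTwist) : LFunction.HasEntireContinuation (heckeLFunction χ) := by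
  obtain ⟨χ₀, ν, hχ₀, hν, hdec⟩ := exists_isUnitary_mul_of_norm_eq_rpow hσ
  have hnt₀ : ¬ χ₀.IsNormTwist := not_isNormTwist_of_mul_normPow hν hdec hnt
  obtain ⟨g, hg, hgL⟩ := heckeLFunction_hasEntireContinuation_of_not_isNormTwist_holds χ₀ hχ₀ hnt₀
  refine ⟨fun s => g (s + σ), hg.comp (differentiable_id.add_const (σ : ℂ)), fun s hs => ?_⟩
  show g (s + σ) = heckeLFunction χ s
  rw [hdec, heckeLFunction_mul_eq_of_forall_apply_eq_cpow χ₀ hν s, hgL (s + σ)]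
  rw [Complex.add_re, Complex.ofReal_re]
  linarith

/-- **Entire continuation, exponent form**: for a Hecke character `χ` which is not a norm twist and whose exponent
(the `σ` with `‖χ(x)‖ = ‖x‖^σ`, `exists_norm_apply_eq_ideleNorm_rpow`; unique) is non-negative, `L(s, χ)` has an
entire continuation. This is the binder `hL` of the Katz-type frames (`KatzCM.IsLine`, `IsBaseChangeLine`) for
branch characters of weight `−k`, `k ≥ 1` (exponent `k/2`). [cite: TateThesis1967, Thm. 4.4.1] -/
theorem hasEntireContinuation_heckeLFunction_of_exponent_nonneg {χ : HeckeCharacter K}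
    (hnn : ∀ σ : ℝ, (∀ x : ideleGroup K, ‖((χ x : ℂˣ) : ℂ)‖ = ideleNorm x ^ σ) → 0 ≤ σ)
    (hnt : ¬ χ.IsNormTwist) : LFunction.HasEntireContinuation (heckeLFunction χ) := by
  obtain ⟨σ, hσ⟩ := χ.exists_norm_apply_eq_ideleNorm_rpow
  exact hasEntireContinuation_heckeLFunction_of_norm_eq_rpow hσ (hnn σ hσ) hnt

end HeckeCharacter

end Literature.NumberTheory.GaloisRepresentations

end
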